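import Literature.Geometry.Kaehler.HolomorphicLineBundleCechTwist
import Literature.Geometry.Kaehler.HolomorphicLineBundleCechSkyscraper
import Literature.Geometry.Kaehler.HolomorphicLineBundleCechH0
import Literature.Algebra.Homology.NatCochainPencilCount
import HarnessLib

/-!
# Serre's dimension count on a framed cover: a tower of twists with a transversal pencil

Layer `Literature/Geometry/Kaehler`, sequel of `HolomorphicLineBundleCechTwist` (multiplication by a
section of `Hom(L, L')` on the Čech cochains of a framed cover, `mulCochain`) and
`HolomorphicLineBundleCechSkyscraper` (the skyscraper complex `C•(𝔙, L|_Z)`, restriction `toZ`,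
`Ȟ^{≥1} = 0 ≠ Ȟ⁰`). J.-P. Serre, *Géométrie algébrique et géométrie analytique* (1956), n° 16
Lemme 8: for a tower of cocycle line bundles `L_m` (`m ∈ ℕ`; `L ⊗ 𝒪(mH)`) on ONE framed cover
`𝔙 = (V_k, frame k)` with two multiplications `t_m, t'_m : 𝒪(L_m) → 𝒪(L_{m+1})` (the sections
`1` and `s` of `𝒪(H)`) and the finite set `Z` of common zeros of their coordinates, the MEMBERWISE
analytic facts

* `{t ≠ 0}` is dense in the members (identity principle ⟹ `t` injective on cochains),
* `(t, t')` is a regular pair on every `V_J` (`t' f = t g ⟹ t ∣ f`),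
* a holomorphic function on `V_J` vanishing on `Z ∩ V_J` lies in `(t, t') 𝒪(V_J)`, and `t, t'`
  vanish on `Z`,
* every function on the finite set `Z ∩ V_J` is the restriction of a holomorphic function on `V_J`,

packaged as `HolomorphicLineBundle.TwistPencil`, make the Čech complexes `C•(𝔙, 𝒪(L_m))` a
pencil tower in the sense of `NatCochain.PencilTower` (`TwistPencil.pencilTower`: curve level
`= coker t`, point level `= coker t' mod t ≅ C•(𝔙, L|_Z)`), whence — with the Cartan–Serre
finiteness of `Ȟ^q(𝔙, 𝒪(L_m))` as the remaining input —

* `TwistPencil.exists_pos_finrank_cohomology_zero`: `Ȟ⁰(𝔙, 𝒪(L_{m+1})) ≠ 0` for some `m`, and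
  `TwistPencil.exists_lt_finrank_cohomology_zero` (unbounded);
* `TwistPencil.exists_h0_pos`: for a COVERING framed cover, `h⁰(M, L_{m+1}) > 0` for some `m`
  (`Ȟ⁰ = Γ`, `HolomorphicLineBundleCechH0`), i.e. some twist has a section which is not identically
  zero (`exists_zeroSet_ne_univ_of_h0_pos`).

Everything is proved. The memberwise facts are theorems of the tree on the chart-convex members of
the nested Leray covers (`TransversalPairChart`, `HypersurfaceExtensionChart`,
`HolomorphicInterpolation`, `CousinChartConvex`); feeding them, the Bertini pencil
(`BertiniPencilAnalytic.exists_transverse_flag`) and `DolbeaultLerayDatum.finite_cohomologyL`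
into this file is the dimension count of Serre's théorème A for line cocycles on a projective
surface (`serre_theoremA_lineCocycle_surface`).

## References

* J.-P. Serre, *Géométrie algébrique et géométrie analytique*, Ann. Inst. Fourier 6 (1956), n° 16
  Lemme 8. [SerreGAGA1956]
* J.-P. Serre, *Faisceaux algébriques cohérents*, Ann. of Math. 61 (1955), n° 81. [SerreFAC1955]
-/

noncomputable section

open scoped Manifold ContDiff Topology
open Set Filter Function Literature.Algebra.Homology

namespace Literature.Geometry.Kaehler

namespace HolomorphicLineBundle

variable (ι κ : Type*) (E : Type*) [NormedAddCommGroup E] [NormedSpace ℂ E]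
  (M : Type*) [TopologicalSpace M] [ChartedSpace E M]

/-- **A tower of twists with a transversal pencil on one framed cover.** Data: cocycle line
bundles `L m` (`m ∈ ℕ`) on one indexing of frames, sections `t m`, `t' m` of `Hom(L m, L (m+1))`,
one open family `(V_k, frame k)` with `V_k ⊆ U^{(m)}_{frame k}` for every `m`, and a subset `Z`.
Axioms (all memberwise on the finite intersections `V_J`, in the frame of `J 0`): the two
multiplications commute; `{t ≠ 0}` is dense in the members; `(t, t')` is a regular pair on `𝒪(V_J)`;
holomorphic functions on `V_J` vanishing on `Z ∩ V_J` lie in `(t, t') 𝒪(V_J)`; `t, t'` vanish on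
`Z`; interpolation at `Z ∩ V_J` by holomorphic functions on `V_J`; `Z` is finite and meets a member.
This is Serre's setting `𝓕(m) = 𝓕 ⊗ 𝒪(mH)`, `t, t'` two hyperplane equations in general position,
`Z` their common zeros (GAGA n° 16 Lemme 8), for `𝓕 = 𝒪(L)` on a compact complex surface.
[cite: SerreGAGA1956, n° 16 Lemme 8] -/
structure TwistPencil where
  /-- the tower of bundles `L_m` (`L ⊗ 𝒪(mH)`) -/
  L : ℕ → HolomorphicLineBundle ι E M
  /-- multiplication by the first equation, a section of `Hom(L_m, L_{m+1})` -/
  t : ∀ m, HomSection (L m) (L (m + 1))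
  /-- multiplication by the second equation, a section of `Hom(L_m, L_{m+1})` -/
  t' : ∀ m, HomSection (L m) (L (m + 1))
  /-- the members `V_k` of the framed family -/
  U : κ → Set M
  /-- the members are open -/
  isOpen : ∀ k, IsOpen (U k)
  /-- the frame index of each member -/
  frame : κ → ι
  /-- each member is small for every bundle of the tower -/
  subset : ∀ m k, U k ⊆ (L m).baseSet (frame k)
  /-- the common zero set of the two equations -/
  Z : Set M
  /-- the two multiplications commute: `t'_{m+1} t_m = t_{m+1} t'_m` coordinatewise -/
  coord_comm : ∀ m i, ∀ x ∈ (L m).baseSet i,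
    (t' (m + 1)).coord i x * (t m).coord i x = (t (m + 1)).coord i x * (t' m).coord i x
  /-- `{t ≠ 0}` is dense in every finite intersection (read in the frame of the first index) -/
  dense : ∀ (m : ℕ) {a : ℕ} (J : Fin (a + 1) → κ),
    cechSet U J ⊆ closure {x | (t m).coord (frame (J 0)) x ≠ 0}
  /-- `(t, t')` is a regular pair on `𝒪(V_J)`: `t' f = t g ⟹ f = t h` -/
  regular : ∀ (m : ℕ) {a : ℕ} (J : Fin (a + 1) → κ) (f g : holFunOn E (cechSet U J)),
    (∀ x ∈ cechSet U J, (t' (m + 1)).coord (frame (J 0)) x * (f : M → ℂ) x =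
      (t (m + 1)).coord (frame (J 0)) x * (g : M → ℂ) x) →
    ∃ h : holFunOn E (cechSet U J), ∀ x ∈ cechSet U J,
      (f : M → ℂ) x = (t m).coord (frame (J 0)) x * (h : M → ℂ) x
  /-- a holomorphic function on `V_J` vanishing on `Z ∩ V_J` lies in `(t, t') 𝒪(V_J)` -/
  decompose : ∀ (m : ℕ) {a : ℕ} (J : Fin (a + 1) → κ) (f : holFunOn E (cechSet U J)),
    (∀ x ∈ Z ∩ cechSet U J, (f : M → ℂ) x = 0) →
    ∃ g h : holFunOn E (cechSet U J), ∀ x ∈ cechSet U J,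
      (f : M → ℂ) x = (t (m + 1)).coord (frame (J 0)) x * (g : M → ℂ) x +
        (t' (m + 1)).coord (frame (J 0)) x * (h : M → ℂ) x
  /-- the two equations vanish on `Z` -/
  coord_eq_zero : ∀ m k, ∀ x ∈ Z ∩ U k, (t m).coord (frame k) x = 0 ∧ (t' m).coord (frame k) x = 0
  /-- interpolation: every function on `Z ∩ V_J` is the restriction of a holomorphic function -/
  interpolate : ∀ {a : ℕ} (J : Fin (a + 1) → κ) (v : M → ℂ),
    ∃ f : holFunOn E (cechSet U J), ∀ x ∈ Z ∩ cechSet U J, (f : M → ℂ) x = v x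
  /-- `Z` is finite -/
  finite_Z : Z.Finite
  /-- `Z` meets a member -/
  meets : ∃ z ∈ Z, ∃ k, z ∈ U k

namespace TwistPencil

variable {ι κ E M} (T : TwistPencil ι κ E M)

/-! ### The framed covers of the tower and the three families of cochain maps -/

/-- **The framed cover `𝔙` as a framed cover of `L_m`.** [cite: SerreGAGA1956, n° 16 Lemme 8] -/
def cover (m : ℕ) : (T.L m).FramedCover κ where
  U := T.U
  isOpen := T.isOpen
  frame := T.frame
  subset := T.subset m

/-- The members of the covers (definitional). [folklore] -/
@[simp]
theorem cover_U (m : ℕ) : (T.cover m).U = T.U :=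
  rfl

/-- The frames of the covers (definitional). [folklore] -/
@[simp]
theorem cover_frame (m : ℕ) : (T.cover m).frame = T.frame :=
  rfl

/-- Transferring the cover of `L_m` to `L_{m+1}` gives the cover of `L_{m+1}` (definitional).
[folklore] -/
theorem transfer_cover (m : ℕ) :
    (T.cover m).transfer (T.L (m + 1)) (T.subset (m + 1)) = T.cover (m + 1) :=
  rfl

/-- **Multiplication by `t_m` on cochains**, `C•(𝔙, 𝒪(L_m)) → C•(𝔙, 𝒪(L_{m+1}))`.
[cite: SerreGAGA1956, n° 16 Lemme 8] -/
def tC (m a : ℕ) : (T.cover m).Cochain a →ₗ[ℂ] (T.cover (m + 1)).Cochain a :=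
  (T.cover m).mulCochain (T.t m) (T.subset (m + 1)) a

/-- **Multiplication by `t'_m` on cochains**, `C•(𝔙, 𝒪(L_m)) → C•(𝔙, 𝒪(L_{m+1}))`.
[cite: SerreGAGA1956, n° 16 Lemme 8] -/
def t'C (m a : ℕ) : (T.cover m).Cochain a →ₗ[ℂ] (T.cover (m + 1)).Cochain a :=
  (T.cover m).mulCochain (T.t' m) (T.subset (m + 1)) a

/-- **Restriction to `Z`**, `C•(𝔙, 𝒪(L_{m+2})) → C•(𝔙, L_{m+2}|_Z)`. [cite: SerreFAC1955, n° 81] -/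
def evC (m a : ℕ) : (T.cover (m + 2)).Cochain a →ₗ[ℂ] (T.cover (m + 2)).ZCochain T.Z a :=
  (T.cover (m + 2)).toZ T.Z a

/-- `tC` at a point of `V_J`. [folklore] -/
theorem tC_apply_apply_of_mem {m a : ℕ} (c : (T.cover m).Cochain a) {J : Fin (a + 1) → κ} {x : M}
    (hx : x ∈ cechSet T.U J) :
    (T.tC m a c J : M → ℂ) x = (T.t m).coord (T.frame (J 0)) x * (c J : M → ℂ) x :=
  (T.cover m).mulCochain_apply_apply_of_mem (T.t m) (T.subset (m + 1)) c hx

/-- `t'C` at a point of `V_J`. [folklore] -/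
theorem t'C_apply_apply_of_mem {m a : ℕ} (c : (T.cover m).Cochain a) {J : Fin (a + 1) → κ} {x : M}
    (hx : x ∈ cechSet T.U J) :
    (T.t'C m a c J : M → ℂ) x = (T.t' m).coord (T.frame (J 0)) x * (c J : M → ℂ) x :=
  (T.cover m).mulCochain_apply_apply_of_mem (T.t' m) (T.subset (m + 1)) c hx

/-! ### Regularity: `t'` is a non-zero-divisor modulo `t` on cochains -/

/-- **`t'_{m+1} x ∈ t_{m+1} C•(L_{m+1}) ⟹ x ∈ t_m C•(L_m)`** (the regular pair memberwise).
[cite: SerreGAGA1956, n° 16 Lemme 8] -/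
theorem mem_range_tC_of_t'C_mem {m a : ℕ} (x : (T.cover (m + 1)).Cochain a)
    (hx : T.t'C (m + 1) a x ∈ LinearMap.range (T.tC (m + 1) a)) :
    x ∈ LinearMap.range (T.tC m a) := by
  obtain ⟨y, hy⟩ := hx
  have hJ : ∀ J : Fin (a + 1) → κ, ∃ h : holFunOn E (cechSet T.U J), ∀ p ∈ cechSet T.U J,
      (x J : M → ℂ) p = (T.t m).coord (T.frame (J 0)) p * (h : M → ℂ) p := fun J ↦ by
    refine T.regular m J (x J) (y J) fun p hp ↦ ?_
    have h := congr_fun (congr_arg Subtype.val (congr_fun hy J)) p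
    rw [T.tC_apply_apply_of_mem _ hp, T.t'C_apply_apply_of_mem _ hp] at h
    exact h.symm
  choose h hh using hJ
  refine ⟨h, funext fun J ↦ Subtype.ext (funext fun p ↦ ?_)⟩
  by_cases hp : p ∈ cechSet T.U J
  · rw [T.tC_apply_apply_of_mem _ hp, hh J p hp]
  · rw [holFunOn.apply_of_notMem (x J) hp]
    exact holFunOn.apply_of_notMem _ hp

/-! ### The kernel and the image of the restriction to `Z` -/

/-- A cochain restricting to zero on `Z` vanishes at the points of `Z` in the members. [folklore] -/
theorem apply_eq_zero_of_evC_eq_zero {m a : ℕ} {c : (T.cover (m + 2)).Cochain a}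
    (hc : T.evC m a c = 0) (J : Fin (a + 1) → κ) {p : M} (hp : p ∈ T.Z ∩ cechSet T.U J) :
    (c J : M → ℂ) p = 0 := by
  have h := congr_fun (congr_arg Subtype.val (congr_fun hc J)) p
  rw [evC, (T.cover (m + 2)).toZ_apply_apply_of_mem T.Z c hp] at h
  exact h

/-- **`ker (C•(L_{m+2}) → C•(L_{m+2}|_Z)) = t C•(L_{m+1}) + t' C•(L_{m+1})`** (the local
Nullstellensatz memberwise, and the vanishing of `t, t'` on `Z`). [cite: SerreGAGA1956, n° 16 Lemme 8] -/
theorem ker_evC (m a : ℕ) :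
    LinearMap.ker (T.evC m a) =
      LinearMap.range (T.tC (m + 1) a) ⊔ LinearMap.range (T.t'C (m + 1) a) := by
  ext c
  constructor
  · intro hc
    rw [LinearMap.mem_ker] at hc
    have hJ : ∀ J : Fin (a + 1) → κ, ∃ g h : holFunOn E (cechSet T.U J), ∀ p ∈ cechSet T.U J,
        (c J : M → ℂ) p = (T.t (m + 1)).coord (T.frame (J 0)) p * (g : M → ℂ) p +
          (T.t' (m + 1)).coord (T.frame (J 0)) p * (h : M → ℂ) p := fun J ↦
      T.decompose m J (c J) fun p hp ↦ T.apply_eq_zero_of_evC_eq_zero hc J hp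
    choose g h hgh using hJ
    refine Submodule.mem_sup.2 ⟨T.tC (m + 1) a g, ⟨g, rfl⟩, T.t'C (m + 1) a h, ⟨h, rfl⟩, ?_⟩
    funext J
    refine Subtype.ext (funext fun p ↦ ?_)
    change (T.tC (m + 1) a g J : M → ℂ) p + (T.t'C (m + 1) a h J : M → ℂ) p = (c J : M → ℂ) p
    by_cases hp : p ∈ cechSet T.U J
    · rw [T.tC_apply_apply_of_mem _ hp, T.t'C_apply_apply_of_mem _ hp, hgh J p hp]
    · rw [holFunOn.apply_of_notMem _ hp, holFunOn.apply_of_notMem _ hp,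
        holFunOn.apply_of_notMem _ hp, add_zero]
  · intro hc
    obtain ⟨_, ⟨g, rfl⟩, _, ⟨h, rfl⟩, rfl⟩ := Submodule.mem_sup.1 hc
    rw [LinearMap.mem_ker, map_add]
    have hzero : ∀ (s : HomSection (T.L (m + 1)) (T.L (m + 2)))
        (hs : ∀ k, ∀ x ∈ T.Z ∩ T.U k, s.coord (T.frame k) x = 0) (b : (T.cover (m + 1)).Cochain a),
        T.evC m a ((T.cover (m + 1)).mulCochain s (T.subset (m + 2)) a b) = 0 := by
      intro s hs b
      funext J
      refine Subtype.ext (funext fun p ↦ ?_)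
      by_cases hp : p ∈ T.Z ∩ cechSet T.U J
      · rw [evC, (T.cover (m + 2)).toZ_apply_apply_of_mem T.Z _ hp]
        change ((T.cover (m + 1)).mulCochain s (T.subset (m + 2)) a b J : M → ℂ) p = 0
        rw [(T.cover (m + 1)).mulCochain_apply_apply_of_mem s (T.subset (m + 2)) b hp.2,
          show (T.cover (m + 1)).frame (J 0) = T.frame (J 0) from rfl,
          hs (J 0) p ⟨hp.1, cechSet_subset_apply T.U J 0 hp.2⟩, zero_mul]
      · rw [evC, (T.cover (m + 2)).toZ_apply_apply_of_notMem T.Z _ hp]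
        rfl
    rw [show T.tC (m + 1) a g = (T.cover (m + 1)).mulCochain (T.t (m + 1)) (T.subset (m + 2)) a g
        from rfl, show T.t'C (m + 1) a h =
        (T.cover (m + 1)).mulCochain (T.t' (m + 1)) (T.subset (m + 2)) a h from rfl,
      hzero _ (fun k x hx ↦ (T.coord_eq_zero (m + 1) k x hx).1) g,
      hzero _ (fun k x hx ↦ (T.coord_eq_zero (m + 1) k x hx).2) h, add_zero]

/-- **Restriction to `Z` is surjective on cochains** (interpolation memberwise).
[cite: SerreGAGA1956, n° 16 Lemme 8] -/
theorem evC_surjective (m a : ℕ) : Surjective (T.evC m a) := by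
  intro v
  have hJ : ∀ J : Fin (a + 1) → κ, ∃ f : holFunOn E (cechSet T.U J), ∀ p ∈ T.Z ∩ cechSet T.U J,
      (f : M → ℂ) p = (v J : M → ℂ) p := fun J ↦ T.interpolate J (v J)
  choose f hf using hJ
  refine ⟨f, funext fun J ↦ Subtype.ext (funext fun p ↦ ?_)⟩
  by_cases hp : p ∈ T.Z ∩ cechSet T.U J
  · rw [evC, (T.cover (m + 2)).toZ_apply_apply_of_mem T.Z _ hp]
    exact hf J p hp
  · rw [evC, (T.cover (m + 2)).toZ_apply_apply_of_notMem T.Z _ hp,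
      suppFunOn.apply_of_notMem (v J) hp]

/-! ### The pencil tower of the Čech complexes -/

/-- **The Čech complexes `C•(𝔙, 𝒪(L_m))` with `t, t'` and the restriction to `Z` form a pencil
tower** (`NatCochain.PencilTower`). [cite: SerreGAGA1956, n° 16 Lemme 8] -/
def pencilTower :
    NatCochain.PencilTower (K := ℂ) (fun m a ↦ (T.cover m).delta a)
      (fun m a ↦ (T.cover (m + 2)).zdelta T.Z a) where
  t := T.tC
  t' := T.t'C
  ev := T.evC
  d_d m a x := (T.cover m).delta_delta a x
  comm_t m a x := ((T.cover m).delta_mulCochain (T.t m) (T.subset (m + 1)) a x).symm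
  comm_t' m a x := ((T.cover m).delta_mulCochain (T.t' m) (T.subset (m + 1)) a x).symm
  t'_t m a x := (T.cover m).mulCochain_mulCochain_comm (T.t m) (T.t' (m + 1)) (T.t' m) (T.t (m + 1))
    (T.subset (m + 1)) (T.subset (m + 2)) (T.subset (m + 1)) (T.coord_comm m) a x
  injective_t m _ := (T.cover m).mulCochain_injective (T.t m) (T.subset (m + 1)) (T.dense m)
  regular _ _ x hx := T.mem_range_tC_of_t'C_mem x hx
  comm_ev m a x := (T.cover (m + 2)).toZ_delta T.Z a x
  surjective_ev := T.evC_surjective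
  ker_ev := T.ker_evC

/-! ### The dimension count -/

section Count

variable [Finite κ] [Nonempty κ]
  (hfin : ∀ m q, FiniteDimensional ℂ ((T.cover m).cohomology q))

omit [Nonempty κ] in
/-- `Ȟ^q(𝔙, L_{m+2}|_Z)` is finite-dimensional (`Z` finite, finitely many members). [folklore] -/
theorem finiteDimensional_zcohomology (m q : ℕ) :
    FiniteDimensional ℂ ((T.cover (m + 2)).zcohomology T.Z q) :=
  (T.cover (m + 2)).finiteDimensional_zcohomology T.Z T.finite_Z q

/-- **The base inequality `h¹(Z) < h⁰(Z)`**: the skyscraper complex has no `Ȟ¹` and a non-zero `Ȟ⁰`.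
[cite: SerreFAC1955, n° 81] -/
theorem finrank_zcohomology_one_lt (m : ℕ) :
    Module.finrank ℂ ((T.cover (m + 2)).zcohomology T.Z 1) <
      Module.finrank ℂ ((T.cover (m + 2)).zcohomology T.Z 0) := by
  haveI := (T.cover (m + 2)).subsingleton_zcohomology_succ T.Z 0
  haveI := T.finiteDimensional_zcohomology m 0
  obtain ⟨z, hz, k, hk⟩ := T.meets
  haveI : Nontrivial ((T.cover (m + 2)).zcohomology T.Z 0) :=
    (T.cover (m + 2)).nontrivial_zcohomology_zero hz (k₀ := k) hk
  rw [Module.finrank_zero_of_subsingleton]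
  exact Module.finrank_pos

include hfin in
/-- **Serre's dimension count on a framed cover**: if every `Ȟ^q(𝔙, 𝒪(L_m))` is
finite-dimensional (Cartan–Serre), then `Ȟ⁰(𝔙, 𝒪(L_{m+1})) ≠ 0` for some `m`.
[cite: SerreGAGA1956, n° 16 Lemme 8] -/
theorem exists_pos_finrank_cohomology_zero :
    ∃ m, 0 < Module.finrank ℂ ((T.cover (m + 1)).cohomology 0) :=
  T.pencilTower.exists_pos_finrank_cohomology_zero (fun m q ↦ hfin m q)
    (fun m ↦ T.finiteDimensional_zcohomology m 0) (fun m ↦ T.finiteDimensional_zcohomology m 1)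
    fun m ↦ T.finrank_zcohomology_one_lt m

include hfin in
/-- **Serre's dimension count on a framed cover, growth form**: `dim Ȟ⁰(𝔙, 𝒪(L_{m+1}))` is
unbounded. [cite: SerreGAGA1956, n° 16 Lemme 8] -/
theorem exists_lt_finrank_cohomology_zero (B : ℕ) :
    ∃ m, B < Module.finrank ℂ ((T.cover (m + 1)).cohomology 0) :=
  T.pencilTower.exists_lt_finrank_cohomology_zero (fun m q ↦ hfin m q)
    (fun m ↦ T.finiteDimensional_zcohomology m 0) (fun m ↦ T.finiteDimensional_zcohomology m 1)
    (fun m ↦ T.finrank_zcohomology_one_lt m) B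

include hfin in
/-- **Some twist has a non-zero section**: for a COVERING framed family, `h⁰(M, L_{m+1}) > 0` for
some `m` (`Ȟ⁰(𝔙, 𝒪(L)) = Γ(M, L)`, `finrank_cohomology_zero`). [cite: SerreGAGA1956, n° 16 Lemme 8] -/
theorem exists_h0_pos (hcov : ∀ x : M, ∃ k, x ∈ T.U k) : ∃ m, 0 < (T.L (m + 1)).h0 := by
  obtain ⟨m, hm⟩ := T.exists_pos_finrank_cohomology_zero hfin
  exact ⟨m, by rwa [(T.cover (m + 1)).finrank_cohomology_zero hcov] at hm⟩

include hfin in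
/-- **`h⁰(M, L_{m+1})` is unbounded** for a covering framed family. [cite: SerreGAGA1956, n° 16 Lemme 8] -/
theorem exists_lt_h0 (hcov : ∀ x : M, ∃ k, x ∈ T.U k) (B : ℕ) : ∃ m, B < (T.L (m + 1)).h0 := by
  obtain ⟨m, hm⟩ := T.exists_lt_finrank_cohomology_zero hfin B
  exact ⟨m, by rwa [(T.cover (m + 1)).finrank_cohomology_zero hcov] at hm⟩

end Count

end TwistPencil

end HolomorphicLineBundle

end Literature.Geometry.Kaehler

end
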